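import Summits.QuantumFields.YangMills.Theorems.UnitScaleTiltProp7CritEL
import Summits.QuantumFields.YangMills.Theorems.UnitScaleTiltProp7B8Prop7Div
import HarnessLib

/-!
# Route `UnitScaleTilt`, crux K1 child «MinimiserStabilityRegPr» (stmt-QuantumFields-19200), skeleton v10 {`stub_halvingStep`, `stub_existenceMinimalOrbit`} (OWNER RULING
# g24-№5) — ROUTE (α) INTO THE STUB EX, THE SPINE: [Balaban1985Variational] Prop. 7 (ii) ⇐ «∃ an Euler–Lagrange-critical small Landau `X`» (Prop. 6, ∃-half, E–L reading)
# ∧ «E–L-critical regular configurations minimise over (6)(e)» ((141)–(142) + [Balaban1985RegularSpaces] Thm 2's covering, E–L reading); the return to (18) is a THEOREM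

Cell `ym3-torus`, width seat `ym-ust-19200-w2` (gen 0; №5 (4): «w2 = route (α): `IsCritELAt` schema text → spine → C∃-EL»).  YM₃ on T³ is a ladder rung (R3), not the Clay
problem; nothing here is a claim about the crux, d = 4 or the mass gap.

THE E–L SCHEMA (def-free; displayed as hypothesis text, `Prop7CritEL` §2 proves R2-critical ⇒ it).  For a datum `V` and a configuration `W` of the member `(F, n, K)`:
  «EL(V, W)» := for every curve `γ : ℝ → SU(2)^{bonds}` with `γ 0 = W`, `γ t ∈ 𝔅_k(V)` for all `t`, and every bond variable `t ↦ γ t b ∈ M₂(ℂ)` differentiable at `0`: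
  `deriv (t ↦ A(γ t)) 0 = 0` — the constrained first-order condition of (5) on `𝔅_k(V)`, print's variational equation (111) read before the chart (47)–(48).
  «CritEL(V, U₀, U₁)» := `∃ u` restricted (1.29), `(U₁U₀)^u` axial rel. `U₀` (1.19), `(U₁U₀)^u ∈ 𝔅_k(V)`, and EL(V, (U₁U₀)^u) — w1's `CritLPrint` with `IsCritR2` replaced by
  EL (+ the fibre clause that `IsCritR2` carried).
THE TWO ROUTE-(α) SUB-LEMMA TEXTS (hypotheses `hC`, `hE` of §2, displayed in full there):
  (C∃-EL) [Balaban1985Variational] Props 5–6, existence half: over every (14)-background `(V, U₀)` of a (7)-datum, `∃ X` Hermitian-traceless in the (19)-ball `ε₄`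
          (`2B₀L³B₃ε₁ ≤ ε₄ ≤ a₄`) with (20), (21), CritEL(V, U₀, e^{iX}) and (112) `nMax19 X < 3B₀L³B₃ε₁` — the contraction (116)–(121);
  (E-EL)  (141)–(142) with Thm 2's covering and (116)'s convexity: for `0 < ε₁ ≤ a₆`, (7)-datum `V`, `L³B₃ε₁ ≤ e ≤ e₅`, every `W ∈ (6)(e) ∩ 𝔅_k(V)` with EL(V, W) minimises
          the Wilson action over (6)(e).
WHAT IS PROVED (sorry-free, no definition).
§1 **`rowD_EL`** — the p. 299 return to (18) for E–L-critical chart points (criticality-free engine `Prop7B8Prop7Div.regPr_emb15_of_in19`, `O₂ = 178`, `c = ¼`): from (14), (19) at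
   `ε₂ ∈ [L³B₃ε₁, ¼]` and CritEL(V, U₀, U₁): the axial representative `(U₁U₀)^u` lies in `𝔘_k(178ε₂) ∩ 𝔅_k(V)` and is E–L-critical.
§2 **`existenceMinimalOrbit_of_routeAlpha`** — at every `L > 1`, `B₃ > 4`: (C∃-EL) ∧ (E-EL) ⇒ the registered text of `stub_existenceMinimalOrbit` at `(L, B₃)` VERBATIM
   (`O₁ := 178·max{1, 3B₀}`, `a₁′ := min{a₄/(2B₀L³B₃), e₅/(O₁L³B₃), 1/(4·max{1,3B₀}·L³B₃), a₆}`).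
§3 `critEL_of_critLPrint` — w1's R2 letter implies the E–L letter (`Prop7CritEL.deriv_comp_eq_zero_of_isCritR2`), so every R2-row of v8 implies its E–L twin's hypothesis side.

HONEST SCOPE.  (C∃-EL) and (E-EL) are HYPOTHESES (print's Sects. C–E: [Balaban1985Variational] Props 3–6, (116), (141)–(142); [Balaban1985RegularSpaces] Thm 2); this file is the
kernel-checked passage from them to the stub EX.  Count-neutral helper toward stmt-QuantumFields-19200 (`--supports`), a SUB-LEMMA of the stub EX, not its proof.

References: T. Bałaban, CMP 102 (1985) 277–309 [Balaban1985Variational] ((5)–(7) p.278, (14) p.280, (18)–(21) pp.280–281, (111)–(112) p.294, Props 5–6 pp.294–295, (116) p.295,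
(141)–(142) p.299, Prop. 7 p.299); CMP 99 (1985) 75–102 [Balaban1985RegularSpaces] (Thm 2 p.83, Prop. 7 (1.144) p.100).
-/

noncomputable section

open scoped Matrix.Norms.L2Operator Topology

namespace Summit.QuantumFields.YangMills.Theorems.Prop7ExistRouteAlpha

open Literature.MathematicalPhysics.QuantumFieldTheory.Balaban1983to89
open Literature.MathematicalPhysics.QuantumFieldTheory.Balaban1983to89.T3ContinuumYM3Torus
open Literature.MathematicalPhysics.QuantumFieldTheory.Balaban1983to89.T3UnitLawDensityEML (ℰp)
open Literature.MathematicalPhysics.QuantumFieldTheory.Balaban1983to89.T3DescentFibreTower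
open Literature.MathematicalPhysics.QuantumFieldTheory.Balaban1983to89.T3ConstrainedMinimiser
open Literature.MathematicalPhysics.QuantumFieldTheory.Balaban1983to89.T3TiltDescent
open Literature.MathematicalPhysics.QuantumFieldTheory.Balaban1983to89.T3PrintedRegularMinimiser
open Literature.MathematicalPhysics.QuantumFieldTheory.Balaban1983to89.T3PrintedMinimiserExistence (regPr_mono)
open Literature.MathematicalPhysics.QuantumFieldTheory.Balaban1983to89.T3PrintedRegularOrbits (regPr_gaugeAct_iff)
open Literature.MathematicalPhysics.QuantumFieldTheory.Balaban1983to89.T3Thm1Carrier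
open Literature.MathematicalPhysics.QuantumFieldTheory.Balaban1983to89.T3Thm1CarrierNative (IsCritR2)
open Literature.MathematicalPhysics.QuantumFieldTheory.Balaban1983to89.T3SectALandauChart
open Summit.QuantumFields.YangMills.Theorems.Prop7TPrint
open Summit.QuantumFields.YangMills.Theorems.Prop7SPrint
open Summit.QuantumFields.YangMills.Theorems.Prop7PV3CDELogChart (in19_expHermField_of_nMax19_lt pos_of_in19)
open Summit.QuantumFields.YangMills.Theorems.Prop7B8Prop7Div (regPr_emb15_of_in19)
open Summit.QuantumFields.YangMills.Theorems.Prop7CritEL (deriv_comp_eq_zero_of_isCritR2 continuousAt_of_differentiableAt_bonds)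

variable {L : ℕ}

/-! ## §1 The return to (18) for E–L-critical chart points (row D, E–L twin; a theorem) -/

/-- **ROW (D), E–L TWIN**: over a (14)-background `U₀ ∈ 𝔘_k(L³B₃ε₁)`, a perturbation `U₁ = e^{iX}` in (19) at `ε₂ ∈ [L³B₃ε₁, ¼]` with CritEL(V, U₀, U₁) has its axial representative
`(U₁U₀)^u ∈ 𝔘_k(178ε₂) ∩ 𝔅_k(V)`, E–L-critical ([Balaban1985RegularSpaces] Prop. 7's estimate `Prop7B8Prop7Div.regPr_emb15_of_in19`, gauge invariance of (2)).
[cite: Balaban1985Variational, p.299 (18)-(21); Balaban1985RegularSpaces, Prop. 7 (1.144) p.100] -/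
theorem rowD_EL (B₃ : ℝ) (i : Idx L) (ε₁ ε₂ : ℝ) (V : GaugeField (i.1.1.P i.1.2.1) 0 (Matrix.specialUnitaryGroup (Fin 2) ℂ))
    (U₀ U₁ : GaugeField (i.1.1.P i.1.2.2) 0 (Matrix.specialUnitaryGroup (Fin 2) ℂ)) (X : PBond (i.1.1.P i.1.2.2) 0 → Matrix (Fin 2) (Fin 2) ℂ)
    (hlo : (L : ℝ) ^ 3 * B₃ * ε₁ ≤ ε₂) (hhi : ε₂ ≤ 1 / 4) (hU₀ : RegPr i.1.1 i.1.2.1 i.1.2.2 ((L : ℝ) ^ 3 * B₃ * ε₁) U₀)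
    (h19 : In19 i.1.1 i.1.2.1 i.1.2.2 ε₂ U₀ U₁ X)
    (hcrit :
      (∃ u : GaugeTransf (i.1.1.P i.1.2.2) 0 (Matrix.specialUnitaryGroup (Fin 2) ℂ), RestrictedPrint i.1.1 i.1.2.1 i.1.2.2 U₀ u ∧
        IsAxialPrint i.1.1 i.1.2.1 i.1.2.2 U₀ (GaugeField.gaugeAct u (emb15 U₀ U₁)) ∧
        GaugeField.gaugeAct u (emb15 U₀ U₁) ∈ fibre i.1.1 ℰp i.1.2.1 i.1.2.2 i.2.2.le V ∧
        (∀ γ : ℝ → GaugeField (i.1.1.P i.1.2.2) 0 (Matrix.specialUnitaryGroup (Fin 2) ℂ), γ 0 = GaugeField.gaugeAct u (emb15 U₀ U₁) →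
          (∀ t, γ t ∈ fibre i.1.1 ℰp i.1.2.1 i.1.2.2 i.2.2.le V) →
          (∀ b, DifferentiableAt ℝ (fun t => ((γ t b : Matrix.specialUnitaryGroup (Fin 2) ℂ) : Matrix (Fin 2) (Fin 2) ℂ)) 0) →
            deriv (fun t => wilsonAction4 (γ t)) 0 = 0))) :
    ∃ u : GaugeTransf (i.1.1.P i.1.2.2) 0 (Matrix.specialUnitaryGroup (Fin 2) ℂ), RestrictedPrint i.1.1 i.1.2.1 i.1.2.2 U₀ u ∧
      RegPr i.1.1 i.1.2.1 i.1.2.2 (178 * ε₂) (GaugeField.gaugeAct u (emb15 U₀ U₁)) ∧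
      GaugeField.gaugeAct u (emb15 U₀ U₁) ∈ fibre i.1.1 ℰp i.1.2.1 i.1.2.2 i.2.2.le V ∧
      IsAxialPrint i.1.1 i.1.2.1 i.1.2.2 U₀ (GaugeField.gaugeAct u (emb15 U₀ U₁)) ∧
          (∀ γ : ℝ → GaugeField (i.1.1.P i.1.2.2) 0 (Matrix.specialUnitaryGroup (Fin 2) ℂ), γ 0 = (GaugeField.gaugeAct u (emb15 U₀ U₁)) →
            (∀ t, γ t ∈ fibre i.1.1 ℰp i.1.2.1 i.1.2.2 i.2.2.le V) →
            (∀ b, DifferentiableAt ℝ (fun t => ((γ t b : Matrix.specialUnitaryGroup (Fin 2) ℂ) : Matrix (Fin 2) (Fin 2) ℂ)) 0) →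
              deriv (fun t => wilsonAction4 (γ t)) 0 = 0) := by
  obtain ⟨⟨F, n, K⟩, hF, hnK⟩ := i
  obtain ⟨u, hu, hax, hfib, hEL⟩ := hcrit
  have hε₂ : 0 < ε₂ := pos_of_in19 h19
  have hreg : RegPr F n K (178 * ε₂) (emb15 U₀ U₁) := regPr_emb15_of_in19 (F := F) (n := n) (K := K) hhi hlo hU₀ h19
  exact ⟨u, hu, (regPr_gaugeAct_iff F (by positivity) u _).mpr hreg, hfib, hax, hEL⟩

/-! ## §2 The spine: EX ⇐ (C∃-EL) ∧ (E-EL) -/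

/-- **ROUTE (α) SPINE — `stub_existenceMinimalOrbit` ⇐ (C∃-EL) ∧ (E-EL)** (p. 299 of print, E–L reading): Prop. 6's E–L-critical `X` over the (14)-background `U₀ ∈ 𝔅_k(V)` of the stub's
binder, (112) ⇒ (19) at `max{1,3B₀}·L³B₃ε₁`, §1 ⇒ the axial representative `W ∈ 𝔘_k(O₁L³B₃ε₁) ∩ 𝔅_k(V)` E–L-critical, (E-EL) at `e = O₁L³B₃ε₁` ⇒ `W` minimises over (6)(e).
Constants: `O₁ = 178·max{1, 3B₀}`, `a₁′ = min{a₄/(2B₀L³B₃), e₅/(O₁L³B₃), 1/(4·max{1,3B₀}L³B₃), a₆}`. [cite: Balaban1985Variational, Prop. 7 p.299, (112) p.294, (141)-(142) p.299] -/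
theorem existenceMinimalOrbit_of_routeAlpha (hL : 1 < L) {B₃ : ℝ} (hB₃ : 4 < B₃)
    (hC : ∃ B₀ a₄ : ℝ, 0 < B₀ ∧ 0 < a₄ ∧ ∀ (i : Idx L) (ε₁ ε₄ : ℝ), 0 < ε₁ → ε₄ ≤ a₄ → 2 * B₀ * (L : ℝ) ^ 3 * B₃ * ε₁ ≤ ε₄ →
        ∀ (V : GaugeField (i.1.1.P i.1.2.1) 0 (Matrix.specialUnitaryGroup (Fin 2) ℂ)) (U₀ : GaugeField (i.1.1.P i.1.2.2) 0 (Matrix.specialUnitaryGroup (Fin 2) ℂ)),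
          PlaqSmall ε₁ V → RegPr i.1.1 i.1.2.1 i.1.2.2 ((L : ℝ) ^ 3 * B₃ * ε₁) U₀ → CloseAvg i.1.1 i.1.2.1 i.1.2.2 i.2.2.le ((L : ℝ) ^ 3 * ε₁) V U₀ →
          ∃ X : PBond (i.1.1.P i.1.2.2) 0 → Matrix (Fin 2) (Fin 2) ℂ,
            nMax19 i.1.1 i.1.2.1 i.1.2.2 U₀ X < ε₄ ∧ (∀ b : PBond (i.1.1.P i.1.2.2) 0, (X b).IsHermitian ∧ Matrix.trace (X b) = 0) ∧
            AvgCondPrint i.1.1 i.1.2.1 i.1.2.2 i.2.2.le V U₀ X ∧ IsLandauPrint i.1.1 i.1.2.1 i.1.2.2 U₀ X ∧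
            (∃ u : GaugeTransf (i.1.1.P i.1.2.2) 0 (Matrix.specialUnitaryGroup (Fin 2) ℂ), RestrictedPrint i.1.1 i.1.2.1 i.1.2.2 U₀ u ∧
              IsAxialPrint i.1.1 i.1.2.1 i.1.2.2 U₀ (GaugeField.gaugeAct u (emb15 U₀ (expHermField X))) ∧
              GaugeField.gaugeAct u (emb15 U₀ (expHermField X)) ∈ fibre i.1.1 ℰp i.1.2.1 i.1.2.2 i.2.2.le V ∧
              (∀ γ : ℝ → GaugeField (i.1.1.P i.1.2.2) 0 (Matrix.specialUnitaryGroup (Fin 2) ℂ), γ 0 = GaugeField.gaugeAct u (emb15 U₀ (expHermField X)) →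
                (∀ t, γ t ∈ fibre i.1.1 ℰp i.1.2.1 i.1.2.2 i.2.2.le V) →
                (∀ b, DifferentiableAt ℝ (fun t => ((γ t b : Matrix.specialUnitaryGroup (Fin 2) ℂ) : Matrix (Fin 2) (Fin 2) ℂ)) 0) →
                  deriv (fun t => wilsonAction4 (γ t)) 0 = 0)) ∧
            nMax19 i.1.1 i.1.2.1 i.1.2.2 U₀ X < 3 * B₀ * (L : ℝ) ^ 3 * B₃ * ε₁)
    (hE : ∃ e₅ a₆ : ℝ, 0 < e₅ ∧ 0 < a₆ ∧ ∀ (i : Idx L) (e ε₁ : ℝ) (V : GaugeField (i.1.1.P i.1.2.1) 0 (Matrix.specialUnitaryGroup (Fin 2) ℂ))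
        (W : GaugeField (i.1.1.P i.1.2.2) 0 (Matrix.specialUnitaryGroup (Fin 2) ℂ)),
        0 < ε₁ → ε₁ ≤ a₆ → PlaqSmall ε₁ V → (L : ℝ) ^ 3 * B₃ * ε₁ ≤ e → e ≤ e₅ →
        W ∈ regFibrePr i.1.1 i.1.2.1 i.1.2.2 i.2.2.le e V →
        (∀ γ : ℝ → GaugeField (i.1.1.P i.1.2.2) 0 (Matrix.specialUnitaryGroup (Fin 2) ℂ), γ 0 = W →
          (∀ t, γ t ∈ fibre i.1.1 ℰp i.1.2.1 i.1.2.2 i.2.2.le V) →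
          (∀ b, DifferentiableAt ℝ (fun t => ((γ t b : Matrix.specialUnitaryGroup (Fin 2) ℂ) : Matrix (Fin 2) (Fin 2) ℂ)) 0) →
            deriv (fun t => wilsonAction4 (γ t)) 0 = 0) →
          IsMinOn (fun W' : GaugeField (i.1.1.P i.1.2.2) 0 (Matrix.specialUnitaryGroup (Fin 2) ℂ) => wilsonAction4 W') (regFibrePr i.1.1 i.1.2.1 i.1.2.2 i.2.2.le e V) W) :
    ∃ a₁' O₁ : ℝ, 0 < a₁' ∧ 1 ≤ O₁ ∧
    ∀ (F : T3Family), F.L = L → ∀ (n K : ℕ) (hnK : n < K) (ε₁ : ℝ), 0 < ε₁ →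
      ∀ V : GaugeField (F.P n) 0 (Matrix.specialUnitaryGroup (Fin 2) ℂ), PlaqSmall ε₁ V →
        ∀ U₀ : GaugeField (F.P K) 0 (Matrix.specialUnitaryGroup (Fin 2) ℂ), RegPr F n K ((L : ℝ) ^ 3 * B₃ * ε₁) U₀ → U₀ ∈ fibre F ℰp n K hnK.le V →
          ε₁ ≤ a₁' → ∃ U ∈ regFibrePr F n K hnK.le (O₁ * (L : ℝ) ^ 3 * B₃ * ε₁) V,
            IsMinOn (fun W : GaugeField (F.P K) 0 (Matrix.specialUnitaryGroup (Fin 2) ℂ) => wilsonAction4 W)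
              (regFibrePr F n K hnK.le (O₁ * (L : ℝ) ^ 3 * B₃ * ε₁) V) U := by
  have hL1 : (1 : ℝ) ≤ (L : ℝ) := by exact_mod_cast hL.le
  have hC₁pos : (0 : ℝ) < (L : ℝ) ^ 3 := by positivity
  have hB₃0 : 0 < B₃ := by linarith
  obtain ⟨B₀, a₄, hB₀, ha₄, HC⟩ := hC
  obtain ⟨e₅, a₆, he₅, ha₆, HE⟩ := hE
  set M : ℝ := max 1 (3 * B₀) with hM
  have hM1 : 1 ≤ M := le_max_left _ _
  have hM3 : 3 * B₀ ≤ M := le_max_right _ _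
  have hM0 : 0 < M := lt_of_lt_of_le one_pos hM1
  have hK : 0 < 2 * B₀ * (L : ℝ) ^ 3 * B₃ := by positivity
  have hK' : 0 < 178 * M * (L : ℝ) ^ 3 * B₃ := by positivity
  have hK'' : 0 < M * (L : ℝ) ^ 3 * B₃ := by positivity
  set a₁' : ℝ := min (min (min (a₄ / (2 * B₀ * (L : ℝ) ^ 3 * B₃)) (e₅ / (178 * M * (L : ℝ) ^ 3 * B₃))) ((1 / 4) / (M * (L : ℝ) ^ 3 * B₃))) a₆ with ha₁'
  have ha₁'0 : 0 < a₁' := lt_min (lt_min (lt_min (div_pos ha₄ hK) (div_pos he₅ hK')) (div_pos (by norm_num) hK'')) ha₆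
  refine ⟨a₁', 178 * M, ha₁'0, by nlinarith, ?_⟩
  intro F hF n K hnK ε₁ hε₁ V hV U₀ hU₀ hB hε₁a
  obtain ⟨hreg, hclose⟩ := sat14T3_of_mem_fibre (h := hnK.le) (mul_pos hC₁pos hε₁) hU₀ hB
  have h2B : 2 * B₀ * (L : ℝ) ^ 3 * B₃ * ε₁ ≤ a₄ := by
    have := (le_div_iff₀ hK).1 (hε₁a.trans ((min_le_left _ _).trans ((min_le_left _ _).trans (min_le_left _ _)))); linarith
  have hcap : 178 * (M * (L : ℝ) ^ 3 * B₃ * ε₁) ≤ e₅ := by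
    have := (le_div_iff₀ hK').1 (hε₁a.trans ((min_le_left _ _).trans ((min_le_left _ _).trans (min_le_right _ _)))); linarith
  have hquarter : M * (L : ℝ) ^ 3 * B₃ * ε₁ ≤ 1 / 4 := by
    have := (le_div_iff₀ hK'').1 (hε₁a.trans ((min_le_left _ _).trans (min_le_right _ _))); linarith
  have hε₁a₆ : ε₁ ≤ a₆ := hε₁a.trans (min_le_right _ _)
  -- (C∃-EL) at ε₄ = a₄
  obtain ⟨X, -, hX, h20, h21, hcrit, hX3⟩ := HC ⟨(F, n, K), hF, hnK⟩ ε₁ a₄ hε₁ le_rfl h2B V U₀ hV hreg hclose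
  -- (112) ⇒ (19) at M·L³B₃ε₁
  have h19 : In19 F n K (M * (L : ℝ) ^ 3 * B₃ * ε₁) U₀ (expHermField X) X := by
    have hmono : 3 * B₀ * (L : ℝ) ^ 3 * B₃ * ε₁ ≤ M * (L : ℝ) ^ 3 * B₃ * ε₁ := by
      have : 0 ≤ (L : ℝ) ^ 3 * B₃ * ε₁ := by positivity
      nlinarith
    exact in19_expHermField_of_nMax19_lt hX (lt_of_lt_of_le hX3 hmono)
  have hlo : (L : ℝ) ^ 3 * B₃ * ε₁ ≤ M * (L : ℝ) ^ 3 * B₃ * ε₁ := by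
    have : 0 ≤ (L : ℝ) ^ 3 * B₃ * ε₁ := by positivity
    nlinarith
  -- the return to (18), E–L twin
  obtain ⟨u, _hu, hRegW, hWfib, _hWax, hWEL⟩ := rowD_EL B₃ ⟨(F, n, K), hF, hnK⟩ ε₁ (M * (L : ℝ) ^ 3 * B₃ * ε₁) V U₀ (expHermField X) X hlo hquarter hreg h19 hcrit
  -- (E-EL) at e = 178·M·L³B₃ε₁
  have hlow : (L : ℝ) ^ 3 * B₃ * ε₁ ≤ 178 * (M * (L : ℝ) ^ 3 * B₃ * ε₁) := by
    have : 0 ≤ M * (L : ℝ) ^ 3 * B₃ * ε₁ := by positivity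
    nlinarith
  have hWmem : GaugeField.gaugeAct u (emb15 U₀ (expHermField X)) ∈ regFibrePr F n K hnK.le (178 * (M * (L : ℝ) ^ 3 * B₃ * ε₁)) V :=
    (mem_regFibrePr_iff F).mpr ⟨hWfib, hRegW⟩
  have hWmin := HE ⟨(F, n, K), hF, hnK⟩ (178 * (M * (L : ℝ) ^ 3 * B₃ * ε₁)) ε₁ V (GaugeField.gaugeAct u (emb15 U₀ (expHermField X))) hε₁ hε₁a₆ hV hlow hcap hWmem hWEL
  have hO : 178 * M * (L : ℝ) ^ 3 * B₃ * ε₁ = 178 * (M * (L : ℝ) ^ 3 * B₃ * ε₁) := by ring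
  refine ⟨GaugeField.gaugeAct u (emb15 U₀ (expHermField X)), ?_, ?_⟩
  · rw [hO]; exact hWmem
  · rw [hO]; exact hWmin

/-! ## §3 R2-rows imply E–L-rows on the hypothesis side -/

/-- **w1's R2 LETTER IMPLIES THE E–L LETTER**: `CritLPrint V U₀ U₁` ⇒ CritEL(V, U₀, U₁) (Fermat along fibre-valued curves, `Prop7CritEL.deriv_comp_eq_zero_of_isCritR2`; the fibre
clause comes from `IsCritR2`'s regular-fibre membership). [cite: Balaban1985Variational, (111) p.294, p.300] -/
theorem critEL_of_critLPrint (i : Idx L) (V : GaugeField (i.1.1.P i.1.2.1) 0 (Matrix.specialUnitaryGroup (Fin 2) ℂ))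
    (U₀ U₁ : GaugeField (i.1.1.P i.1.2.2) 0 (Matrix.specialUnitaryGroup (Fin 2) ℂ)) (h : CritLPrint i.1.1 i.1.2.1 i.1.2.2 i.2.2.le V U₀ U₁) :
      (∃ u : GaugeTransf (i.1.1.P i.1.2.2) 0 (Matrix.specialUnitaryGroup (Fin 2) ℂ), RestrictedPrint i.1.1 i.1.2.1 i.1.2.2 U₀ u ∧
        IsAxialPrint i.1.1 i.1.2.1 i.1.2.2 U₀ (GaugeField.gaugeAct u (emb15 U₀ U₁)) ∧
        GaugeField.gaugeAct u (emb15 U₀ U₁) ∈ fibre i.1.1 ℰp i.1.2.1 i.1.2.2 i.2.2.le V ∧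
        (∀ γ : ℝ → GaugeField (i.1.1.P i.1.2.2) 0 (Matrix.specialUnitaryGroup (Fin 2) ℂ), γ 0 = GaugeField.gaugeAct u (emb15 U₀ U₁) →
          (∀ t, γ t ∈ fibre i.1.1 ℰp i.1.2.1 i.1.2.2 i.2.2.le V) →
          (∀ b, DifferentiableAt ℝ (fun t => ((γ t b : Matrix.specialUnitaryGroup (Fin 2) ℂ) : Matrix (Fin 2) (Fin 2) ℂ)) 0) →
            deriv (fun t => wilsonAction4 (γ t)) 0 = 0)) := by
  obtain ⟨⟨F, n, K⟩, hF, hnK⟩ := i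
  obtain ⟨u, hu, hax, hR2⟩ := h
  obtain ⟨e, _he, hmem, _hmin⟩ := hR2
  refine ⟨u, hu, hax, ((mem_regFibrePr_iff F).mp hmem).1, fun γ hγ0 hγfib hγd => ?_⟩
  exact deriv_comp_eq_zero_of_isCritR2 ⟨e, _he, hmem, _hmin⟩ γ hγ0 hγfib (continuousAt_of_differentiableAt_bonds γ hγd)

end Summit.QuantumFields.YangMills.Theorems.Prop7ExistRouteAlpha

end
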